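import Summits.QuantumFields.BalabanUV.Beta.GAN24.CombChartChargeTowerClosure
import Summits.QuantumFields.BalabanUV.Beta.GAN24.CurrentSymTowerComb

/-!
# `BalabanUV.Beta.GAN24.CombChartChargeTowerPairFormClosed` — binder row G-an2-4 ∕ (CONV-C), TRANSFER-III, the (III′) (C)-campaign in branch (i) of E0: **THE PLUG AT an1's RECORD** —
# MY `CombChartChargeTowerClosure` at `tabs := symTablesAn1S2 3 Lc cΛt` with the FACE supplier `hBF` DISCHARGED BY NAME (leaf-04 g77's `CurrentSymTowerComb.forcingFacePairForms_comb_an1_holds`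
# — road-P2's `hBF m i` SHAPE for the comb forcing at an1's record with NO displayed hypothesis, over leaf-02 g78's `CombForcingPairForm` §5) and the record's border blocks by `rfl`:
# **the comb-chart member's leg-and-bond-symmetrised ff zero-mode charge AND all its deep face reads are PAIR FORMS at EVERY level ⟸ `hB0` ALONE** (the comb forcing's CELL pair form
# at every level — the ONE remaining supplier of the (III′) (C)-campaign's closure; its l = 0 and l = 1 instances are what Engine C's E0 (✓ branch (i), `ccons/E0.md` 970a5b77…) and E1
# (running) read BY VALUE) — the (III′) twin of road-P2 g51's `CombChargeTowerPairFormClosed.pairFormLS_member_and_faceReads` with `hB0` displayed instead of leaf-06's (E) supplier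
# (OWNER `b2b-balaban-gan24-p1`, gen 51; no existing file touched)

NOT IN PRINT; OUR BOOKKEEPING ([folklore] ONE `exact`; 0 `def`, 0 cited facts, 0 `def … : Prop`, 0 sorry).  HONEST FRAMING (cell contract, verbatim): «discharging `BetaPertH` makes Bałaban's
UV stability UNCONDITIONAL — a real constructive-QFT result; it is NOT the continuum limit and NOT the Clay problem.»  HONEST DEPENDENCY (verbatim): «continuum YM on T⁴ ⇐ BetaPertH ∧ nine spine
estimates (0/9 proved); BetaPertH ⇐ (D1) ∧ (D4) ∧ CAP+tail; G-an2-4 gates asym, D1 and NE2/3/4.»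
WHAT: **`pairFormLS_member_and_faceReads_an1`** `(cΛt cE cVH cΛ cE₂ cB c M) (P) (hP0) (hPs) (hB0) (i)` — generic constants (`cΛt` the record's Λ-weight, `cΛ` the recursion's; Wilson table
`c • wsym22 M`), `hB0` DISPLAYED.  WHAT THIS IS NOT: `hB0` is a HYPOTHESIS (NOT typed at (III′): memo M-1 §2 row «`hB0` = leaf-06 #66's twin … the campaign's CORE RISK», its VALUE files);
asserts NO value ∕ shape of any table; discharges NOTHING of (C) ∕ (d′) ∕ (d″) ∕ the S-slot rows; NEVER «G-an2-4 closed» as (CONV-C); NOT D1, NOT `BetaPertH`, NOT continuum, NOT Clay; not in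
print.  2026-08-27.
-/

noncomputable section

open Finset
open scoped BigOperators
open Literature.MathematicalPhysics.QuantumFieldTheory
open Literature.MathematicalPhysics.QuantumFieldTheory.Balaban1983to89
open Literature.MathematicalPhysics.QuantumFieldTheory.Balaban1983to89.Beta
open ExpKernelCalculus (Site MKer shiftK)
open OneStepResolventKernel (Fib)
open OneStepKernelFamily (KInvStep)
open BalabanCompositeJets (LocStencil₂)
open SecondOrderResponse (W2SymOfK)
open BalabanStepJetsSucc (mmRead)
open BalabanStepW2 (K3OfK M2Of)
open WilsonVertex2Sym (wsym22)
open AffineAveraging (box toSite)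
open Summit.QuantumFields.BalabanUV.Beta.HessKerDressedUnits (unitK unitS)
open Summit.QuantumFields.BalabanUV.Beta.SecondOrderUnits (unitM unitS₂ unitM₂)
open Summit.QuantumFields.BalabanUV.Beta.AxialDressingRooted (one_le_of_neZero)
open Summit.QuantumFields.BalabanUV.Beta.SpineRooted (T2RecOf)
open Summit.QuantumFields.BalabanUV.Beta.CombChartStepJets (GcombSh SpureCombOf)
open Summit.QuantumFields.BalabanUV.Beta.SymSecondOrderTablesAn1 (symTablesAn1S2)
open Summit.QuantumFields.BalabanUV.Beta.GAN24.CombesThomas (sfStep smStep)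
open Summit.QuantumFields.BalabanUV.Beta.GAN24.BiStencilZeroMode (Tab zmode)
open Summit.QuantumFields.BalabanUV.Beta.GAN24.CombChartChargeTowerClosure (pairFormLS_member_and_faceReads_of_forcingPairForms)
open Summit.QuantumFields.BalabanUV.Beta.GAN24.CurrentSymTowerComb (forcingFacePairForms_comb_an1_holds)

namespace Summit.QuantumFields.BalabanUV.Beta.GAN24.CombChartChargeTowerPairFormClosed

variable {Lc : ℕ} [NeZero Lc]

/-- NOT IN PRINT; OUR BOOKKEEPING.  **THE COMB-CHART MEMBER's SYMMETRISED CHARGE AND ALL ITS FACE READS ARE PAIR FORMS AT EVERY LEVEL ⟸ `hB0` ALONE** (an1's record; `hBF` by leaf-04 g77's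
`forcingFacePairForms_comb_an1_holds`, the border's ff ∕ mm blocks by `rfl`). -/
theorem pairFormLS_member_and_faceReads_an1 (cΛt cE cVH cΛ cE₂ cB c : ℝ) (M : ℕ)
    (P : ℕ → ℕ) (hP0 : P 0 = Lc) (hPs : ∀ m, P (m + 1) = Lc * P m)
    (hB0 : ∀ i : ℕ, ∃ T : Fin (3 + 1) → Fin (3 + 1) → Fin (3 + 1) → Fin (3 + 1) → ℝ,
      (∀ a b c e : Fin (3 + 1), T b a c e = -T a b c e) ∧ (∀ a b c e : Fin (3 + 1), T a b e c = -T a b c e) ∧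
      ∀ κ κ' κ₁ κ₂ : Fin (3 + 1),
        (zmode Lc ((fun κ u κ' u' => (cE₂ * (Lc : ℝ) ^ (2 * (3 + 1))) • mmRead Lc (K3OfK (unitK (sfStep Lc i) (smStep 3 Lc i) (GcombSh (d := 3) Lc i)) Lc (unitS (sfStep Lc i) (smStep 3 Lc i) (SpureCombOf (symTablesAn1S2 3 Lc cΛt) cE cVH cΛ i)) (unitM (sfStep Lc i) (smStep 3 Lc i) ((symTablesAn1S2 3 Lc cΛt).M i)) (W2SymOfK (unitK (sfStep Lc i) (smStep 3 Lc i) (GcombSh (d := 3) Lc i)) Lc (unitS (sfStep Lc i) (smStep 3 Lc i) (SpureCombOf (symTablesAn1S2 3 Lc cΛt) cE cVH cΛ i)) (unitM (sfStep Lc i) (smStep 3 Lc i) ((symTablesAn1S2 3 Lc cΛt).M i)) 0 (unitM₂ (sfStep Lc i) (smStep 3 Lc i) (M2Of 3 Lc (symTablesAn1S2 3 Lc cΛt).mixFF i))) κ u κ' u') + cB • (symTablesAn1S2 3 Lc cΛt).vh₂S κ u κ' u')) κ κ' (Sum.inl κ₁) (Sum.inl κ₂)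
      + zmode Lc ((fun κ u κ' u' => (cE₂ * (Lc : ℝ) ^ (2 * (3 + 1))) • mmRead Lc (K3OfK (unitK (sfStep Lc i) (smStep 3 Lc i) (GcombSh (d := 3) Lc i)) Lc (unitS (sfStep Lc i) (smStep 3 Lc i) (SpureCombOf (symTablesAn1S2 3 Lc cΛt) cE cVH cΛ i)) (unitM (sfStep Lc i) (smStep 3 Lc i) ((symTablesAn1S2 3 Lc cΛt).M i)) (W2SymOfK (unitK (sfStep Lc i) (smStep 3 Lc i) (GcombSh (d := 3) Lc i)) Lc (unitS (sfStep Lc i) (smStep 3 Lc i) (SpureCombOf (symTablesAn1S2 3 Lc cΛt) cE cVH cΛ i)) (unitM (sfStep Lc i) (smStep 3 Lc i) ((symTablesAn1S2 3 Lc cΛt).M i)) 0 (unitM₂ (sfStep Lc i) (smStep 3 Lc i) (M2Of 3 Lc (symTablesAn1S2 3 Lc cΛt).mixFF i))) κ u κ' u') + cB • (symTablesAn1S2 3 Lc cΛt).vh₂S κ u κ' u')) κ' κ (Sum.inl κ₁) (Sum.inl κ₂)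
      + (zmode Lc ((fun κ u κ' u' => (cE₂ * (Lc : ℝ) ^ (2 * (3 + 1))) • mmRead Lc (K3OfK (unitK (sfStep Lc i) (smStep 3 Lc i) (GcombSh (d := 3) Lc i)) Lc (unitS (sfStep Lc i) (smStep 3 Lc i) (SpureCombOf (symTablesAn1S2 3 Lc cΛt) cE cVH cΛ i)) (unitM (sfStep Lc i) (smStep 3 Lc i) ((symTablesAn1S2 3 Lc cΛt).M i)) (W2SymOfK (unitK (sfStep Lc i) (smStep 3 Lc i) (GcombSh (d := 3) Lc i)) Lc (unitS (sfStep Lc i) (smStep 3 Lc i) (SpureCombOf (symTablesAn1S2 3 Lc cΛt) cE cVH cΛ i)) (unitM (sfStep Lc i) (smStep 3 Lc i) ((symTablesAn1S2 3 Lc cΛt).M i)) 0 (unitM₂ (sfStep Lc i) (smStep 3 Lc i) (M2Of 3 Lc (symTablesAn1S2 3 Lc cΛt).mixFF i))) κ u κ' u') + cB • (symTablesAn1S2 3 Lc cΛt).vh₂S κ u κ' u')) κ κ' (Sum.inl κ₂) (Sum.inl κ₁)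
      + zmode Lc ((fun κ u κ' u' => (cE₂ * (Lc : ℝ) ^ (2 * (3 + 1))) • mmRead Lc (K3OfK (unitK (sfStep Lc i) (smStep 3 Lc i) (GcombSh (d := 3) Lc i)) Lc (unitS (sfStep Lc i) (smStep 3 Lc i) (SpureCombOf (symTablesAn1S2 3 Lc cΛt) cE cVH cΛ i)) (unitM (sfStep Lc i) (smStep 3 Lc i) ((symTablesAn1S2 3 Lc cΛt).M i)) (W2SymOfK (unitK (sfStep Lc i) (smStep 3 Lc i) (GcombSh (d := 3) Lc i)) Lc (unitS (sfStep Lc i) (smStep 3 Lc i) (SpureCombOf (symTablesAn1S2 3 Lc cΛt) cE cVH cΛ i)) (unitM (sfStep Lc i) (smStep 3 Lc i) ((symTablesAn1S2 3 Lc cΛt).M i)) 0 (unitM₂ (sfStep Lc i) (smStep 3 Lc i) (M2Of 3 Lc (symTablesAn1S2 3 Lc cΛt).mixFF i))) κ u κ' u') + cB • (symTablesAn1S2 3 Lc cΛt).vh₂S κ u κ' u')) κ' κ (Sum.inl κ₂) (Sum.inl κ₁)))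
          = T κ κ₁ κ' κ₂ + T κ' κ₁ κ κ₂ + (T κ κ₂ κ' κ₁ + T κ' κ₂ κ κ₁))
    (i : ℕ) :
    (∃ R : Fin (3 + 1) → Fin (3 + 1) → Fin (3 + 1) → Fin (3 + 1) → ℝ,
      (∀ a b c e : Fin (3 + 1), R b a c e = -R a b c e) ∧ (∀ a b c e : Fin (3 + 1), R a b e c = -R a b c e) ∧
      ∀ κ κ' κ₁ κ₂ : Fin (3 + 1),
        (zmode Lc (unitS₂ (sfStep Lc i) (smStep 3 Lc i) (T2RecOf 3 Lc (GcombSh Lc) (SpureCombOf (symTablesAn1S2 3 Lc cΛt) cE cVH cΛ) (symTablesAn1S2 3 Lc cΛt).M cE₂ cB (c • wsym22 M) (symTablesAn1S2 3 Lc cΛt).vh₂S (symTablesAn1S2 3 Lc cΛt).mixFF i)) κ κ' (Sum.inl κ₁) (Sum.inl κ₂)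
      + zmode Lc (unitS₂ (sfStep Lc i) (smStep 3 Lc i) (T2RecOf 3 Lc (GcombSh Lc) (SpureCombOf (symTablesAn1S2 3 Lc cΛt) cE cVH cΛ) (symTablesAn1S2 3 Lc cΛt).M cE₂ cB (c • wsym22 M) (symTablesAn1S2 3 Lc cΛt).vh₂S (symTablesAn1S2 3 Lc cΛt).mixFF i)) κ' κ (Sum.inl κ₁) (Sum.inl κ₂)
      + (zmode Lc (unitS₂ (sfStep Lc i) (smStep 3 Lc i) (T2RecOf 3 Lc (GcombSh Lc) (SpureCombOf (symTablesAn1S2 3 Lc cΛt) cE cVH cΛ) (symTablesAn1S2 3 Lc cΛt).M cE₂ cB (c • wsym22 M) (symTablesAn1S2 3 Lc cΛt).vh₂S (symTablesAn1S2 3 Lc cΛt).mixFF i)) κ κ' (Sum.inl κ₂) (Sum.inl κ₁)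
      + zmode Lc (unitS₂ (sfStep Lc i) (smStep 3 Lc i) (T2RecOf 3 Lc (GcombSh Lc) (SpureCombOf (symTablesAn1S2 3 Lc cΛt) cE cVH cΛ) (symTablesAn1S2 3 Lc cΛt).M cE₂ cB (c • wsym22 M) (symTablesAn1S2 3 Lc cΛt).vh₂S (symTablesAn1S2 3 Lc cΛt).mixFF i)) κ' κ (Sum.inl κ₂) (Sum.inl κ₁)))
          = R κ κ₁ κ' κ₂ + R κ' κ₁ κ κ₂ + (R κ κ₂ κ' κ₁ + R κ' κ₂ κ κ₁))
    ∧ (∀ m : ℕ, ∃ R : Fin (3 + 1) → Fin (3 + 1) → Fin (3 + 1) → Fin (3 + 1) → ℝ,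
      (∀ a b c e : Fin (3 + 1), R b a c e = -R a b c e) ∧ (∀ a b c e : Fin (3 + 1), R a b e c = -R a b c e) ∧
      ∀ κ κ' κ₁ κ₂ : Fin (3 + 1),
        (((∑ bb ∈ box (3 + 1) (P m), ∑' u' : Site (3 + 1), ∑' x : Site (3 + 1), ∑' z : Site (3 + 1),
          (if toSite bb κ % ((P m : ℕ) : ℤ) = ((P m : ℕ) : ℤ) - 1 ∧ u' κ' % ((P m : ℕ) : ℤ) = ((P m : ℕ) : ℤ) - 1 ∧ x κ₁ % ((P m : ℕ) : ℤ) = ((P m : ℕ) : ℤ) - 1 ∧ z κ₂ % ((P m : ℕ) : ℤ) = ((P m : ℕ) : ℤ) - 1 then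
            (unitS₂ (sfStep Lc i) (smStep 3 Lc i) (T2RecOf 3 Lc (GcombSh Lc) (SpureCombOf (symTablesAn1S2 3 Lc cΛt) cE cVH cΛ) (symTablesAn1S2 3 Lc cΛt).M cE₂ cB (c • wsym22 M) (symTablesAn1S2 3 Lc cΛt).vh₂S (symTablesAn1S2 3 Lc cΛt).mixFF i)) κ (toSite bb) κ' u' x z (Sum.inl κ₁) (Sum.inl κ₂) else 0))
        + (∑ bb ∈ box (3 + 1) (P m), ∑' u' : Site (3 + 1), ∑' x : Site (3 + 1), ∑' z : Site (3 + 1),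
          (if toSite bb κ' % ((P m : ℕ) : ℤ) = ((P m : ℕ) : ℤ) - 1 ∧ u' κ % ((P m : ℕ) : ℤ) = ((P m : ℕ) : ℤ) - 1 ∧ x κ₁ % ((P m : ℕ) : ℤ) = ((P m : ℕ) : ℤ) - 1 ∧ z κ₂ % ((P m : ℕ) : ℤ) = ((P m : ℕ) : ℤ) - 1 then
            (unitS₂ (sfStep Lc i) (smStep 3 Lc i) (T2RecOf 3 Lc (GcombSh Lc) (SpureCombOf (symTablesAn1S2 3 Lc cΛt) cE cVH cΛ) (symTablesAn1S2 3 Lc cΛt).M cE₂ cB (c • wsym22 M) (symTablesAn1S2 3 Lc cΛt).vh₂S (symTablesAn1S2 3 Lc cΛt).mixFF i)) κ' (toSite bb) κ u' x z (Sum.inl κ₁) (Sum.inl κ₂) else 0)))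
      + ((∑ bb ∈ box (3 + 1) (P m), ∑' u' : Site (3 + 1), ∑' x : Site (3 + 1), ∑' z : Site (3 + 1),
          (if toSite bb κ' % ((P m : ℕ) : ℤ) = ((P m : ℕ) : ℤ) - 1 ∧ u' κ % ((P m : ℕ) : ℤ) = ((P m : ℕ) : ℤ) - 1 ∧ x κ₁ % ((P m : ℕ) : ℤ) = ((P m : ℕ) : ℤ) - 1 ∧ z κ₂ % ((P m : ℕ) : ℤ) = ((P m : ℕ) : ℤ) - 1 then
            (unitS₂ (sfStep Lc i) (smStep 3 Lc i) (T2RecOf 3 Lc (GcombSh Lc) (SpureCombOf (symTablesAn1S2 3 Lc cΛt) cE cVH cΛ) (symTablesAn1S2 3 Lc cΛt).M cE₂ cB (c • wsym22 M) (symTablesAn1S2 3 Lc cΛt).vh₂S (symTablesAn1S2 3 Lc cΛt).mixFF i)) κ' (toSite bb) κ u' x z (Sum.inl κ₁) (Sum.inl κ₂) else 0))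
        + (∑ bb ∈ box (3 + 1) (P m), ∑' u' : Site (3 + 1), ∑' x : Site (3 + 1), ∑' z : Site (3 + 1),
          (if toSite bb κ % ((P m : ℕ) : ℤ) = ((P m : ℕ) : ℤ) - 1 ∧ u' κ' % ((P m : ℕ) : ℤ) = ((P m : ℕ) : ℤ) - 1 ∧ x κ₁ % ((P m : ℕ) : ℤ) = ((P m : ℕ) : ℤ) - 1 ∧ z κ₂ % ((P m : ℕ) : ℤ) = ((P m : ℕ) : ℤ) - 1 then
            (unitS₂ (sfStep Lc i) (smStep 3 Lc i) (T2RecOf 3 Lc (GcombSh Lc) (SpureCombOf (symTablesAn1S2 3 Lc cΛt) cE cVH cΛ) (symTablesAn1S2 3 Lc cΛt).M cE₂ cB (c • wsym22 M) (symTablesAn1S2 3 Lc cΛt).vh₂S (symTablesAn1S2 3 Lc cΛt).mixFF i)) κ (toSite bb) κ' u' x z (Sum.inl κ₁) (Sum.inl κ₂) else 0)))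
      + (((∑ bb ∈ box (3 + 1) (P m), ∑' u' : Site (3 + 1), ∑' x : Site (3 + 1), ∑' z : Site (3 + 1),
          (if toSite bb κ % ((P m : ℕ) : ℤ) = ((P m : ℕ) : ℤ) - 1 ∧ u' κ' % ((P m : ℕ) : ℤ) = ((P m : ℕ) : ℤ) - 1 ∧ x κ₂ % ((P m : ℕ) : ℤ) = ((P m : ℕ) : ℤ) - 1 ∧ z κ₁ % ((P m : ℕ) : ℤ) = ((P m : ℕ) : ℤ) - 1 then
            (unitS₂ (sfStep Lc i) (smStep 3 Lc i) (T2RecOf 3 Lc (GcombSh Lc) (SpureCombOf (symTablesAn1S2 3 Lc cΛt) cE cVH cΛ) (symTablesAn1S2 3 Lc cΛt).M cE₂ cB (c • wsym22 M) (symTablesAn1S2 3 Lc cΛt).vh₂S (symTablesAn1S2 3 Lc cΛt).mixFF i)) κ (toSite bb) κ' u' x z (Sum.inl κ₂) (Sum.inl κ₁) else 0))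
        + (∑ bb ∈ box (3 + 1) (P m), ∑' u' : Site (3 + 1), ∑' x : Site (3 + 1), ∑' z : Site (3 + 1),
          (if toSite bb κ' % ((P m : ℕ) : ℤ) = ((P m : ℕ) : ℤ) - 1 ∧ u' κ % ((P m : ℕ) : ℤ) = ((P m : ℕ) : ℤ) - 1 ∧ x κ₂ % ((P m : ℕ) : ℤ) = ((P m : ℕ) : ℤ) - 1 ∧ z κ₁ % ((P m : ℕ) : ℤ) = ((P m : ℕ) : ℤ) - 1 then
            (unitS₂ (sfStep Lc i) (smStep 3 Lc i) (T2RecOf 3 Lc (GcombSh Lc) (SpureCombOf (symTablesAn1S2 3 Lc cΛt) cE cVH cΛ) (symTablesAn1S2 3 Lc cΛt).M cE₂ cB (c • wsym22 M) (symTablesAn1S2 3 Lc cΛt).vh₂S (symTablesAn1S2 3 Lc cΛt).mixFF i)) κ' (toSite bb) κ u' x z (Sum.inl κ₂) (Sum.inl κ₁) else 0)))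
      + ((∑ bb ∈ box (3 + 1) (P m), ∑' u' : Site (3 + 1), ∑' x : Site (3 + 1), ∑' z : Site (3 + 1),
          (if toSite bb κ' % ((P m : ℕ) : ℤ) = ((P m : ℕ) : ℤ) - 1 ∧ u' κ % ((P m : ℕ) : ℤ) = ((P m : ℕ) : ℤ) - 1 ∧ x κ₂ % ((P m : ℕ) : ℤ) = ((P m : ℕ) : ℤ) - 1 ∧ z κ₁ % ((P m : ℕ) : ℤ) = ((P m : ℕ) : ℤ) - 1 then
            (unitS₂ (sfStep Lc i) (smStep 3 Lc i) (T2RecOf 3 Lc (GcombSh Lc) (SpureCombOf (symTablesAn1S2 3 Lc cΛt) cE cVH cΛ) (symTablesAn1S2 3 Lc cΛt).M cE₂ cB (c • wsym22 M) (symTablesAn1S2 3 Lc cΛt).vh₂S (symTablesAn1S2 3 Lc cΛt).mixFF i)) κ' (toSite bb) κ u' x z (Sum.inl κ₂) (Sum.inl κ₁) else 0))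
        + (∑ bb ∈ box (3 + 1) (P m), ∑' u' : Site (3 + 1), ∑' x : Site (3 + 1), ∑' z : Site (3 + 1),
          (if toSite bb κ % ((P m : ℕ) : ℤ) = ((P m : ℕ) : ℤ) - 1 ∧ u' κ' % ((P m : ℕ) : ℤ) = ((P m : ℕ) : ℤ) - 1 ∧ x κ₂ % ((P m : ℕ) : ℤ) = ((P m : ℕ) : ℤ) - 1 ∧ z κ₁ % ((P m : ℕ) : ℤ) = ((P m : ℕ) : ℤ) - 1 then
            (unitS₂ (sfStep Lc i) (smStep 3 Lc i) (T2RecOf 3 Lc (GcombSh Lc) (SpureCombOf (symTablesAn1S2 3 Lc cΛt) cE cVH cΛ) (symTablesAn1S2 3 Lc cΛt).M cE₂ cB (c • wsym22 M) (symTablesAn1S2 3 Lc cΛt).vh₂S (symTablesAn1S2 3 Lc cΛt).mixFF i)) κ (toSite bb) κ' u' x z (Sum.inl κ₂) (Sum.inl κ₁) else 0)))))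
          = R κ κ₁ κ' κ₂ + R κ' κ₁ κ κ₂ + (R κ κ₂ κ' κ₁ + R κ' κ₂ κ κ₁)) := by
  exact pairFormLS_member_and_faceReads_of_forcingPairForms (symTablesAn1S2 3 Lc cΛt) cE cVH cΛ cE₂ cB c M
    (fun _ _ _ _ _ _ _ _ => rfl) (fun _ _ _ _ _ _ _ _ => rfl) P hP0 hPs hB0
    (forcingFacePairForms_comb_an1_holds (one_le_of_neZero Lc) cΛt cE cVH cΛ cE₂ cB P hP0 hPs) i

end Summit.QuantumFields.BalabanUV.Beta.GAN24.CombChartChargeTowerPairFormClosed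

end
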